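import Summits.QuantumFields.YangMills.Theorems.ConvexGribovBodyCovarianceBoundDefsB
import Summits.QuantumFields.YangMills.Theorems.ConvexGribovBodyCovarianceBoundStubSupMeasurable
import Summits.QuantumFields.YangMills.Theorems.ConvexGribovBodyCovarianceBoundStubModeReduction
import Literature.MathematicalPhysics.QuantumFieldTheory.CoulombGaugeFPPositivity
import Literature.MathematicalPhysics.QuantumFieldTheory.GribovSupportPlaneWaves
import Literature.MathematicalPhysics.QuantumLattice.RepLieAlgebra
import HarnessLib

/-!
# Stub `stub_supportLie` for the crux `CovarianceBound` (stmt-QuantumFields-8780), line `Sketch`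

Route `QuantumFields/YangMills/ConvexGribovBody`, crux
`Summit.QuantumFields.YangMills.Theses.ConvexGribovBody.CovarianceBound`, skeleton line `Sketch` (v5).
This file proves the registered GEOMETRY stub `stub_supportLie`: **Zwanziger's Gribov-region support
bound for the `𝔤`-part of the mid-link cosine mode**, at every absolute lattice Coulomb minimiser,
`‖P_𝔤 Ĉ_j(p)‖²_F ≤ C (2S+1)⁶ (p̂² + (2π/L)²)`, given perfectness of `𝔤` (`LieAlgPerfect r`, the
line's stub `stub_lieAlgPerfect`).

Proof (Zwanziger, Nucl. Phys. B 364 (1991) 127, Appendix; Nucl. Phys. B 412 (1994) 657, Sect. 2):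
* competitors `h_τ(x) = g_x(τ) h(x)` with `ρ(g_x(τ)) = exp(τ ω_x)`, `ω_x = φ(x)X + ψ(x)Y ∈ 𝔤`
  (one-parameter subgroups lift through the faithful `ρ`), turn absolute minimality into
  `F(τ) ≤ F(0)` for the gauge functional along the family, whence the FP inequality
  (`CoulombFP.abs_sum_pairing_le`: second-derivative test + unitarity);
* plane-wave tests at momenta `±(2π/L)e_a` and `±(2π/L)e_a - p` isolate the pairing
  `Re tr([X,Y] Ĉ_a(p))` (`CoulombFP.abs_sum_cos_mul_le`), bounded by `C_{X,Y} L³ irScale` when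
  `|cos(π p_a/L)| ≥ 1/2`, the complementary case being covered by the trivial bound `N L⁶ ≤ N L⁶ p̂²/3`;
* `Re tr(Z Ĉ) = -⟨Z, P_𝔤 Ĉ⟩` for `Z ∈ 𝔤`; perfectness makes every `P_𝔤 E_n` (canonical basis `E_n`
  of `M_N(ℂ)`) a combination of commutators, and Parseval `‖V‖² = ∑_n ⟨V, E_n⟩²` on `V = P_𝔤 Ĉ ∈ 𝔤`
  concludes.

Helper lemmas live in the sub-namespace `SupportLie`. No named facts are used.
-/

set_option autoImplicit false

noncomputable section

namespace Summit.QuantumFields.YangMills.Cruxes.CovarianceBound.SupportWindow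

open scoped BigOperators Matrix ComplexConjugate
open NormedSpace
open Literature.MathematicalPhysics.QuantumFieldTheory Literature.MathematicalPhysics.QuantumLattice

namespace SupportLie

variable {G : Type} [Group G] [TopologicalSpace G]

/-! ### Lie algebra and one-parameter lifts -/

/-- Elements of `𝔤 = r.lieAlg` lie in the defining set (closed-subgroup theorem, tree
`RepLieAlgebra`). [cite: Hall2015, Theorem 3.20] -/
theorem mem_lieAlgCarrier_of_mem_lieAlg [CompactSpace G] (r : LatticeRep G)
    {X : Matrix (Fin r.N) (Fin r.N) ℂ} (hX : X ∈ r.lieAlg) : X ∈ r.lieAlgCarrier := by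
  have h : r.lieAlgCarrier = (repLieAlgebra r : Set (Matrix (Fin r.N) (Fin r.N) ℂ)) := by
    ext Z
    rw [SetLike.mem_coe, repLieAlgebra_def,
      mem_matrixLieAlgebra_iff r.one_mem_range r.mul_mem_range r.isClosed_range]
    exact ⟨fun hZ => hZ.2,
      fun hZ => ⟨star_eq_neg_of_mem_oneParamGenerators r.range_subset_unitaryGroup hZ, hZ⟩⟩
  have h2 : r.lieAlg = repLieAlgebra r := by rw [LatticeRep.lieAlg, h, Submodule.span_eq]
  rw [h, ← h2]
  exact hX

/-- A lift `g` of `t ↦ exp(tX)` through the faithful `ρ` is additive. [folklore] -/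
theorem lift_add (r : LatticeRep G) {X : Matrix (Fin r.N) (Fin r.N) ℂ} {g : ℝ → G}
    (hg : ∀ t : ℝ, r.ρ (g t) = exp (t • X)) (s t : ℝ) : g (s + t) = g s * g t := by
  apply r.injective
  rw [map_mul, hg, hg, hg, add_smul]
  exact Matrix.exp_add_of_commute _ _ (((Commute.refl X).smul_left s).smul_right t)

/-- `g(-t) = g(t)⁻¹` for such a lift. [folklore] -/
theorem lift_neg (r : LatticeRep G) {X : Matrix (Fin r.N) (Fin r.N) ℂ} {g : ℝ → G}
    (hg : ∀ t : ℝ, r.ρ (g t) = exp (t • X)) (t : ℝ) : g (-t) = (g t)⁻¹ := by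
  have h0 : g 0 = 1 := r.injective (by rw [hg, zero_smul, exp_zero, map_one])
  exact (inv_eq_of_mul_eq_one_right (by rw [← lift_add r hg, add_neg_cancel, h0])).symm

/-! ### The slice functional along one-parameter competitors -/

/-- The slice Coulomb functional as a sum over `(y, j) ↦` the spatial link `((0,y), j+1)`.
[folklore] -/
theorem coulombF_eq (r : LatticeRep G) (S : ℕ) (U : GaugeConfig 4 (2 * S + 1) G)
    (h : Site 4 (2 * S + 1) → G) :
    coulombF r S U h = -∑ q : (Fin 3 → ZMod (2 * S + 1)) × Fin 3,
      (r.ρ (gaugeTransform h U (Fin.cons 0 q.1, q.2.succ))).trace.re := by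
  unfold coulombF
  rw [CoulombFP.sum_edge_slice_eq]

/-- The far endpoint of the spatial link `((0,y), j+1)` is `(0, y + e_j)`. [folklore] -/
theorem tail_cons_shift (S : ℕ) (y : Fin 3 → ZMod (2 * S + 1)) (j : Fin 3) :
    Fin.tail (Site.shift (Fin.cons (0 : ZMod (2 * S + 1)) y) j.succ) = y + Pi.single j 1 := by
  funext i
  simp only [Site.shift, Fin.tail, Pi.add_apply, Fin.cons_succ, Pi.single_apply, Fin.succ_inj]

/-- **Absolute minimality along the competitors `h_τ(x) = g_x(τ) h(x)`**, `ρ(g_x(τ)) = exp(τ ω_x)`,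
`ω_x = φ(x̄)X + ψ(x̄)Y ∈ 𝔤` (`x̄` the spatial part): the gauge functional
`∑ Re tr(e^{τω} W e^{-τω'})` is maximal at `τ = 0`. [cite: Zwanziger1994, Sect. 2] -/
theorem sum_re_trace_competitor_le [CompactSpace G] (r : LatticeRep G) (S : ℕ)
    (U : GaugeConfig 4 (2 * S + 1) G) (h : Site 4 (2 * S + 1) → G) (hmin : IsCoulMin r S U h)
    {X Y : Matrix (Fin r.N) (Fin r.N) ℂ} (hX : X ∈ r.lieAlgCarrier) (hY : Y ∈ r.lieAlgCarrier)
    (φ ψ : (Fin 3 → ZMod (2 * S + 1)) → ℝ) (τ : ℝ) :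
    ∑ q : (Fin 3 → ZMod (2 * S + 1)) × Fin 3,
      (exp (τ • (φ q.1 • X + ψ q.1 • Y)) * r.ρ (gaugeTransform h U (Fin.cons 0 q.1, q.2.succ)) *
        exp (τ • -(φ (q.1 + Pi.single q.2 1) • X + ψ (q.1 + Pi.single q.2 1) • Y))).trace.re ≤
    ∑ q : (Fin 3 → ZMod (2 * S + 1)) × Fin 3,
      (r.ρ (gaugeTransform h U (Fin.cons 0 q.1, q.2.succ))).trace.re := by
  set ω : Site 4 (2 * S + 1) → Matrix (Fin r.N) (Fin r.N) ℂ :=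
    fun x => φ (Fin.tail x) • X + ψ (Fin.tail x) • Y with hω
  have hωmem : ∀ x, ω x ∈ r.lieAlgCarrier := fun x =>
    mem_lieAlgCarrier_of_mem_lieAlg r (Submodule.add_mem _
      (Submodule.smul_mem _ _ (r.lieAlgCarrier_subset_lieAlg hX))
      (Submodule.smul_mem _ _ (r.lieAlgCarrier_subset_lieAlg hY)))
  choose g hg using fun x => (hωmem x).2
  have hle := hmin fun x => g x τ * h x
  rw [coulombF_eq, coulombF_eq, neg_le_neg_iff] at hle
  refine le_of_eq_of_le (Finset.sum_congr rfl fun q _ => ?_) hle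
  obtain ⟨y, j⟩ := q
  have hW : gaugeTransform (fun x => g x τ * h x) U (Fin.cons 0 y, j.succ) =
      g (Fin.cons 0 y) τ * gaugeTransform h U (Fin.cons 0 y, j.succ) *
        (g (Site.shift (Fin.cons 0 y) j.succ) τ)⁻¹ := by
    simp only [gaugeTransform, mul_inv_rev, mul_assoc]
  rw [hW, map_mul, map_mul, hg, ← lift_neg r (hg _) τ, hg, neg_smul, ← smul_neg]
  simp only [hω, Fin.tail_cons, tail_cons_shift]

/-- **The FP inequality at an absolute Coulomb minimiser** (from `CoulombFP.abs_sum_pairing_le`):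
for `X, Y ∈ 𝔤` and all real spatial test functions `φ, ψ`,
`|∑ (φ(y+e_j)ψ(y) - ψ(y+e_j)φ(y)) Re tr(W_{y,j}[X,Y])| ≤ K_{X,Y} ∑ ((Δφ)² + (Δψ)²)`.
[cite: Zwanziger1994, Sect. 2] -/
theorem fp_inequality [CompactSpace G] (r : LatticeRep G) (S : ℕ)
    (U : GaugeConfig 4 (2 * S + 1) G) (h : Site 4 (2 * S + 1) → G) (hmin : IsCoulMin r S U h)
    {X Y : Matrix (Fin r.N) (Fin r.N) ℂ} (hX : X ∈ r.lieAlgCarrier) (hY : Y ∈ r.lieAlgCarrier)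
    (φ ψ : (Fin 3 → ZMod (2 * S + 1)) → ℝ) :
    |∑ q : (Fin 3 → ZMod (2 * S + 1)) × Fin 3, (φ (q.1 + Pi.single q.2 1) * ψ q.1 -
        ψ (q.1 + Pi.single q.2 1) * φ q.1) *
        (r.ρ (gaugeTransform h U (Fin.cons 0 q.1, q.2.succ)) * (X * Y - Y * X)).trace.re| ≤
      Real.sqrt r.N * (frobNorm (X * X) + frobNorm (Y * Y) + frobNorm (X * Y + Y * X)) *
        ∑ q : (Fin 3 → ZMod (2 * S + 1)) × Fin 3, ((φ q.1 - φ (q.1 + Pi.single q.2 1)) ^ 2 +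
          (ψ q.1 - ψ (q.1 + Pi.single q.2 1)) ^ 2) := by
  have hp : ∀ τ : ℝ, _ := fun τ => sum_re_trace_competitor_le r S U h hmin hX hY φ ψ τ
  have hm : ∀ τ : ℝ, _ := fun τ => sum_re_trace_competitor_le r S U h hmin hX hY φ (fun y => -ψ y) τ
  exact CoulombFP.abs_sum_pairing_le (V := Fin 3 → ZMod (2 * S + 1))
    (E := (Fin 3 → ZMod (2 * S + 1)) × Fin 3) Prod.fst (fun q => q.1 + Pi.single q.2 1)
    (fun q => r.ρ (gaugeTransform h U (Fin.cons 0 q.1, q.2.succ)))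
    (fun q => r.mem_unitary (gaugeTransform h U (Fin.cons 0 q.1, q.2.succ))) X Y φ ψ hp hm

/-! ### From the pairing to the cosine mode -/

/-- `Re tr(½(W - Wᴴ) Z) = Re tr(W Z)` for skew-Hermitian `Z`. [folklore] -/
theorem re_trace_half_sub_mul {N : ℕ} (W Z : Matrix (Fin N) (Fin N) ℂ) (hZ : Zᴴ = -Z) :
    (((1 / 2 : ℂ) • (W - Wᴴ)) * Z).trace.re = (W * Z).trace.re := by
  have h1 : (Wᴴ * Z).trace.re = -(W * Z).trace.re := by
    have hc : (Wᴴ * Z)ᴴ = -(Z * W) := by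
      rw [Matrix.conjTranspose_mul, hZ, Matrix.conjTranspose_conjTranspose, neg_mul]
    calc (Wᴴ * Z).trace.re = ((Wᴴ * Z)ᴴ).trace.re := by
          rw [Matrix.trace_conjTranspose, Complex.star_def, Complex.conj_re]
      _ = -(W * Z).trace.re := by rw [hc, Matrix.trace_neg, Complex.neg_re, Matrix.trace_mul_comm]
  rw [Matrix.smul_mul, Matrix.trace_smul, Matrix.sub_mul, Matrix.trace_sub, smul_eq_mul,
    show (1 / 2 : ℂ) = ((1 / 2 : ℝ) : ℂ) by push_cast; ring, Complex.re_ofReal_mul, Complex.sub_re, h1]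
  ring

/-- `⟨Z, Ĉ_a(p)⟩ = -∑_y cos(θ_{y,a}) Re tr(W_{y,a} Z)` for skew-Hermitian `Z` (`Ĉ` is skew-Hermitian,
`Re tr(A_j(y) Z) = Re tr(W_{y,j} Z)`). [folklore] -/
theorem hsForm_cosMode_eq (r : LatticeRep G) (S : ℕ) (p : Fin 3 → ZMod (2 * S + 1)) (a : Fin 3)
    (U : GaugeConfig 4 (2 * S + 1) G) (h : Site 4 (2 * S + 1) → G)
    {Z : Matrix (Fin r.N) (Fin r.N) ℂ} (hZ : Zᴴ = -Z) :
    hsForm r.N Z (cosMode r S p a U h) = -∑ y : Fin 3 → ZMod (2 * S + 1),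
      Real.cos (2 * Real.pi * ((∑ i : Fin 3, ((p i).val : ℝ) * ((y i).val : ℝ)) +
        ((p a).val : ℝ) / 2) / (2 * S + 1)) *
        (r.ρ (gaugeTransform h U (Fin.cons 0 y, a.succ)) * Z).trace.re := by
  rw [hsForm_apply, ModeReduction.cosMode_conjTranspose, Matrix.mul_neg, Matrix.trace_neg,
    Complex.neg_re, Matrix.trace_mul_comm]
  unfold cosMode
  rw [Finset.sum_mul, Matrix.trace_sum, Complex.re_sum]
  refine congrArg _ (Finset.sum_congr rfl fun y _ => ?_)
  rw [Matrix.smul_mul, Matrix.trace_smul, smul_eq_mul, Complex.re_ofReal_mul]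
  unfold gluon
  rw [re_trace_half_sub_mul _ _ hZ]

/-- **The pairing bound for one commutator**: at an absolute Coulomb minimiser, for
`X, Y ∈ 𝔤`, `S ≥ 1` and `|cos(π p_a/L)| ≥ 1/2`,
`|⟨[X,Y], Ĉ_a(p)⟩| ≤ 18π K_{X,Y} L³ · irScale`, `K_{X,Y} = √N (‖X²‖_F + ‖Y²‖_F + ‖XY + YX‖_F)`.
[cite: Zwanziger1991, Appendix] -/
theorem abs_hsForm_bracket_cosMode_le [CompactSpace G] (r : LatticeRep G) (S : ℕ)
    (U : GaugeConfig 4 (2 * S + 1) G) (h : Site 4 (2 * S + 1) → G) (hmin : IsCoulMin r S U h)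
    {X Y : Matrix (Fin r.N) (Fin r.N) ℂ} (hX : X ∈ r.lieAlgCarrier) (hY : Y ∈ r.lieAlgCarrier)
    (p : Fin 3 → ZMod (2 * S + 1)) (a : Fin 3) (hS : 1 ≤ S)
    (ha : 1 / 2 ≤ |Real.cos (Real.pi * (p a).val / (2 * S + 1))|) :
    |hsForm r.N (X * Y - Y * X) (cosMode r S p a U h)| ≤
      9 * (Real.sqrt r.N * (frobNorm (X * X) + frobNorm (Y * Y) + frobNorm (X * Y + Y * X))) *
        (2 * Real.pi) * (2 * S + 1) ^ 3 * irScale S p := by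
  have hL : ((2 * S + 1 : ℕ) : ℝ) = 2 * S + 1 := by push_cast; ring
  have hL3 : 3 ≤ 2 * S + 1 := by omega
  set K : ℝ := Real.sqrt r.N * (frobNorm (X * X) + frobNorm (Y * Y) + frobNorm (X * Y + Y * X))
    with hK
  have hK0 : 0 ≤ K := mul_nonneg (Real.sqrt_nonneg _)
    (add_nonneg (add_nonneg (frobNorm_nonneg _) (frobNorm_nonneg _)) (frobNorm_nonneg _))
  set Z := X * Y - Y * X with hZ
  have hZskew : Zᴴ = -Z := by
    rw [hZ, Matrix.conjTranspose_sub, Matrix.conjTranspose_mul, Matrix.conjTranspose_mul,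
      show Xᴴ = -X from hX.1, show Yᴴ = -Y from hY.1]
    simp only [Matrix.neg_mul, Matrix.mul_neg, neg_neg]
    abel
  -- the momentum phase and its shift constants
  obtain ⟨ϖ, hϖ⟩ : ∃ ϖ : (Fin 3 → ZMod (2 * S + 1)) → ℝ,
      ϖ = fun y => 2 * Real.pi * (∑ i : Fin 3, ((p i).val : ℝ) * ((y i).val : ℝ)) / (2 * S + 1) :=
    ⟨_, rfl⟩
  obtain ⟨σ, hσ⟩ : ∃ σ : Fin 3 → ℝ, σ = fun j => 2 * Real.pi * (p j).val / (2 * S + 1) := ⟨_, rfl⟩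
  have hshift : ∀ y j, ∃ k : ℤ, ϖ (y + Pi.single j 1) = ϖ y + σ j + k * (2 * Real.pi) := by
    intro y j
    obtain ⟨k, hk⟩ := CoulombFP.exists_phase_shift (fun i => ((p i).val : ℤ)) y j
    refine ⟨k, ?_⟩
    simp only [Int.cast_natCast, hL] at hk
    simpa only [hϖ, hσ] using hk
  -- the scale
  have hν : ∀ j, (2 * Real.pi / ((2 * S + 1 : ℕ) : ℝ)) ^ 2 + (2 * Real.sin (σ j / 2)) ^ 2 ≤
      irScale S p ^ 2 := by
    intro j
    rw [hL, irScale_sq, add_comm]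
    refine add_le_add ?_ le_rfl
    have : (2 * Real.sin (σ j / 2)) ^ 2 = 4 * Real.sin (Real.pi * (p j).val / (2 * S + 1)) ^ 2 := by
      simp only [hσ]
      rw [show 2 * Real.pi * ((p j).val : ℝ) / (2 * S + 1) / 2 = Real.pi * (p j).val / (2 * S + 1)
        by ring]
      ring
    rw [this]
    unfold latMomSq
    exact Finset.single_le_sum (f := fun i => 4 * Real.sin (Real.pi * (p i).val / (2 * S + 1)) ^ 2)
      (fun i _ => by positivity) (Finset.mem_univ j)
  have ha' : 1 / 2 ≤ |Real.cos (σ a / 2)| := by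
    simp only [hσ]
    rwa [show 2 * Real.pi * ((p a).val : ℝ) / (2 * S + 1) / 2 = Real.pi * (p a).val / (2 * S + 1)
      by ring]
  have hmain := CoulombFP.abs_sum_cos_mul_le hL3
    (fun q : (Fin 3 → ZMod (2 * S + 1)) × Fin 3 =>
      (r.ρ (gaugeTransform h U (Fin.cons 0 q.1, q.2.succ)) * Z).trace.re)
    hK0 (fun φ ψ => fp_inequality r S U h hmin hX hY φ ψ) hshift (irScale_pos S p) hν a ha'
  rw [hsForm_cosMode_eq r S p a U h hZskew, abs_neg]
  have hphase : ∀ y : Fin 3 → ZMod (2 * S + 1),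
      Real.cos (2 * Real.pi * ((∑ i : Fin 3, ((p i).val : ℝ) * ((y i).val : ℝ)) +
        ((p a).val : ℝ) / 2) / (2 * S + 1)) = Real.cos (ϖ y + σ a / 2) := by
    intro y; simp only [hϖ, hσ]; congr 1; ring
  simp_rw [hphase]
  refine hmain.trans (le_of_eq ?_)
  rw [hL]
  field_simp

/-- **The pairing bound for every `Z ∈ 𝔤`** (perfectness `LieAlgPerfect r`: span induction over
commutators): there is `C = C(Z) ≥ 0` with `|⟨Z, Ĉ_a(p)⟩| ≤ C L³ irScale` at every absolute Coulomb
minimiser, whenever `S ≥ 1` and `|cos(π p_a/L)| ≥ 1/2`. [cite: Zwanziger1991, Appendix] -/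
theorem exists_abs_hsForm_cosMode_le [CompactSpace G] (r : LatticeRep G) (hperf : LieAlgPerfect r)
    {Z : Matrix (Fin r.N) (Fin r.N) ℂ} (hZ : Z ∈ r.lieAlg) :
    ∃ C : ℝ, 0 ≤ C ∧ ∀ (S : ℕ) (U : GaugeConfig 4 (2 * S + 1) G) (h : Site 4 (2 * S + 1) → G),
      IsCoulMin r S U h → ∀ (p : Fin 3 → ZMod (2 * S + 1)) (a : Fin 3), 1 ≤ S →
        1 / 2 ≤ |Real.cos (Real.pi * (p a).val / (2 * S + 1))| →
        |hsForm r.N Z (cosMode r S p a U h)| ≤ C * (2 * S + 1) ^ 3 * irScale S p := by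
  unfold LieAlgPerfect at hperf
  rw [← hperf] at hZ
  induction hZ using Submodule.span_induction with
  | mem Z hZ =>
    obtain ⟨X, hX, Y, hY, rfl⟩ := hZ
    refine ⟨9 * (Real.sqrt r.N * (frobNorm (X * X) + frobNorm (Y * Y) + frobNorm (X * Y + Y * X))) *
      (2 * Real.pi), ?_, fun S U h hmin p a hS ha => ?_⟩
    · refine mul_nonneg (mul_nonneg (by norm_num) (mul_nonneg (Real.sqrt_nonneg _) ?_)) (by positivity)
      exact add_nonneg (add_nonneg (frobNorm_nonneg _) (frobNorm_nonneg _)) (frobNorm_nonneg _)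
    · exact abs_hsForm_bracket_cosMode_le r S U h hmin hX hY p a hS ha
  | zero => exact ⟨0, le_rfl, fun S U h _ p a _ _ => by simp⟩
  | add Z₁ Z₂ _ _ h₁ h₂ =>
    obtain ⟨C₁, hC₁, H₁⟩ := h₁
    obtain ⟨C₂, hC₂, H₂⟩ := h₂
    refine ⟨C₁ + C₂, add_nonneg hC₁ hC₂, fun S U h hmin p a hS ha => ?_⟩
    rw [map_add, LinearMap.add_apply]
    refine (abs_add_le _ _).trans ?_
    have := H₁ S U h hmin p a hS ha
    have := H₂ S U h hmin p a hS ha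
    linarith
  | smul c Z _ hZ' =>
    obtain ⟨C, hC, H⟩ := hZ'
    refine ⟨|c| * C, mul_nonneg (abs_nonneg c) hC, fun S U h hmin p a hS ha => ?_⟩
    rw [map_smul, LinearMap.smul_apply, smul_eq_mul, abs_mul, mul_assoc, mul_assoc]
    exact mul_le_mul_of_nonneg_left (by have := H S U h hmin p a hS ha; linarith) (abs_nonneg c)

/-- Parseval in `(M_N(ℂ), Re tr(X Yᴴ))`: `⟨V, V⟩ = ∑ₙ ⟨V, Eₙ⟩²` for the canonical orthonormal basis
`noiseDir`. [folklore] -/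
theorem hsForm_self_eq_sum_sq {N : ℕ} (V : Matrix (Fin N) (Fin N) ℂ) :
    hsForm N V V = ∑ n : NoiseIdx N, hsForm N V (noiseDir n) ^ 2 := by
  calc hsForm N V V = hsForm N V (∑ n : NoiseIdx N, hsForm N V (noiseDir n) • noiseDir n) := by
        rw [sum_hsForm_noiseDir_smul]
    _ = ∑ n : NoiseIdx N, hsForm N V (noiseDir n) ^ 2 := by
        rw [map_sum]
        exact Finset.sum_congr rfl fun n _ => by rw [map_smul, smul_eq_mul, sq]

end SupportLie

/-! ### The stub -/

open SupportLie in
/-- **Stub `stub_supportLie` — Zwanziger's support bound for the `𝔤`-part of the mid-link cosine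
mode.** For a compact simple `G`, a faithful unitary `r`, and `𝔤` perfect, there is `C = C(G, r) > 0`
such that at every absolute lattice Coulomb minimiser `h` of every configuration `U` on `(2S+1)⁴`,
`‖P_𝔤 Ĉ_j(p)‖²_F ≤ C (2S+1)⁶ (p̂² + (2π/(2S+1))²)` for all momenta `p` and polarisations `j`
(Faddeev–Popov positivity at the minimiser tested on two real plane waves; the window
`|cos(π p_j/L)| ≥ 1/2`, `S ≥ 1` carries the geometry, its complement the trivial bound `N L⁶`).
[cite: Zwanziger1991, Appendix] [cite: Zwanziger1994, Sect. 2] -/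
theorem stub_supportLie :
    ∀ (G : Type) [Group G] [TopologicalSpace G] [IsTopologicalGroup G] [CompactSpace G],
      IsCompactSimpleLieGroup G → ∀ r : LatticeRep G, LieAlgPerfect r →
        ∃ C : ℝ, 0 < C ∧
        ∀ (S : ℕ) (U : GaugeConfig 4 (2 * S + 1) G) (h : Site 4 (2 * S + 1) → G),
          IsCoulMin r S U h → ∀ (p : Fin 3 → ZMod (2 * S + 1)) (j : Fin 3),
            froSq (lieCosMode r S p j U h) ≤
              C * (2 * S + 1 : ℝ) ^ 6 * (latMomSq S p + (2 * Real.pi / (2 * S + 1)) ^ 2) := by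
  intro G _ _ _ _ _ r hperf
  -- one constant per canonical basis direction of `M_N(ℂ)`
  choose C hC0 hC using fun n : NoiseIdx r.N =>
    exists_abs_hsForm_cosMode_le r hperf (r.lieProj_mem (noiseDir n))
  refine ⟨(∑ n, C n ^ 2) + r.N + 1, by positivity, fun S U h hmin p j => ?_⟩
  rw [← irScale_sq]
  have hL : (0 : ℝ) < 2 * S + 1 := by positivity
  have hir := irScale_pos S p
  have hfro : ∀ A : Matrix (Fin r.N) (Fin r.N) ℂ, froSq A = hsForm r.N A A := fun A => by
    rw [hsForm_self]; rfl
  have htriv : froSq (lieCosMode r S p j U h) ≤ r.N * (2 * S + 1 : ℝ) ^ 6 := by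
    refine le_trans ?_ (SupMeasurable.froSq_cosMode_le r S p j U h)
    -- Pythagoras for the `Re tr(X Yᴴ)`-orthogonal projection: `‖P M‖² ≤ ‖P M‖² + ‖M - P M‖² = ‖M‖²`
    set M := cosMode r S p j U h
    have h0 : hsForm r.N (r.lieProj M) (M - r.lieProj M) = 0 :=
      r.hsForm_sub_lieProj (r.lieProj_mem M)
    have h0' : hsForm r.N (M - r.lieProj M) (r.lieProj M) = 0 := by rw [hsForm_comm]; exact h0
    rw [lieCosMode, hfro, hfro M]
    conv_rhs => rw [show M = r.lieProj M + (M - r.lieProj M) by abel]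
    simp only [map_add, LinearMap.add_apply, h0, h0', add_zero, zero_add]
    exact le_add_of_nonneg_right (hsForm_self_nonneg _)
  by_cases hgood : 1 ≤ S ∧ 1 / 2 ≤ |Real.cos (Real.pi * (p j).val / (2 * S + 1))|
  · -- geometry: Parseval over the canonical basis, each coefficient bounded by the pairing bound
    set V := lieCosMode r S p j U h with hV
    have hVmem : V ∈ r.lieAlg := r.lieProj_mem _
    have hcoef : ∀ n, hsForm r.N V (noiseDir n) ^ 2 ≤ C n ^ 2 * ((2 * S + 1) ^ 6 * irScale S p ^ 2) := by
      intro n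
      have h1 : hsForm r.N V (noiseDir n) = hsForm r.N (r.lieProj (noiseDir n)) (cosMode r S p j U h) := by
        have e1 : hsForm r.N V (noiseDir n) = hsForm r.N V (r.lieProj (noiseDir n)) := by
          have := r.hsForm_sub_lieProj (X := noiseDir n) hVmem
          rw [map_sub, sub_eq_zero] at this
          exact this
        have e2 : hsForm r.N (r.lieProj (noiseDir n)) (cosMode r S p j U h) =
            hsForm r.N (r.lieProj (noiseDir n)) V := by
          have := r.hsForm_sub_lieProj (X := cosMode r S p j U h) (r.lieProj_mem (noiseDir n))
          rw [map_sub, sub_eq_zero] at this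
          rw [hV]
          exact this
        rw [e1, hsForm_comm, e2]
      rw [h1]
      have hb := hC n S U h hmin p j hgood.1 hgood.2
      have hb' := abs_le.1 hb
      nlinarith [hC0 n, sq_nonneg (C n * (2 * S + 1) ^ 3 * irScale S p)]
    calc froSq V = hsForm r.N V V := hfro V
      _ = ∑ n, hsForm r.N V (noiseDir n) ^ 2 := hsForm_self_eq_sum_sq V
      _ ≤ ∑ n, C n ^ 2 * ((2 * S + 1) ^ 6 * irScale S p ^ 2) := Finset.sum_le_sum fun n _ => hcoef n
      _ = (∑ n, C n ^ 2) * (2 * S + 1) ^ 6 * irScale S p ^ 2 := by rw [← Finset.sum_mul]; ring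
      _ ≤ ((∑ n, C n ^ 2) + r.N + 1) * (2 * S + 1) ^ 6 * irScale S p ^ 2 := by
          gcongr
          linarith [(Nat.cast_nonneg r.N : (0 : ℝ) ≤ r.N)]
  · -- trivial bound: here `irScale² ≥ 1`
    have hir1 : 1 ≤ irScale S p ^ 2 := by
      rw [irScale_sq]
      rcases Nat.lt_or_ge S 1 with hS | hS
      · have hS0 : S = 0 := by omega
        subst hS0
        have : (2 * Real.pi / (2 * (0 : ℕ) + 1)) ^ 2 = 4 * Real.pi ^ 2 := by push_cast; ring
        rw [this]
        have : 0 ≤ latMomSq 0 p := by unfold latMomSq; exact Finset.sum_nonneg fun i _ => by positivity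
        nlinarith [Real.pi_gt_three]
      · have hcos : |Real.cos (Real.pi * (p j).val / (2 * S + 1))| < 1 / 2 := by
          by_contra hc; exact hgood ⟨hS, not_lt.1 hc⟩
        have hsin : 3 / 4 < Real.sin (Real.pi * (p j).val / (2 * S + 1)) ^ 2 := by
          have := Real.sin_sq_add_cos_sq (Real.pi * (p j).val / (2 * S + 1))
          have hc2 : Real.cos (Real.pi * (p j).val / (2 * S + 1)) ^ 2 < 1 / 4 := by
            have := abs_lt.1 hcos; nlinarith
          linarith
        have hlat : 3 ≤ latMomSq S p := by
          unfold latMomSq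
          refine le_trans (by linarith) (Finset.single_le_sum
            (f := fun i => 4 * Real.sin (Real.pi * (p i).val / (2 * S + 1)) ^ 2)
            (fun i _ => by positivity) (Finset.mem_univ j))
        nlinarith [sq_nonneg (2 * Real.pi / (2 * S + 1))]
    calc froSq (lieCosMode r S p j U h) ≤ r.N * (2 * S + 1 : ℝ) ^ 6 := htriv
      _ ≤ r.N * (2 * S + 1 : ℝ) ^ 6 * irScale S p ^ 2 := by
          refine le_mul_of_one_le_right (by positivity) hir1
      _ ≤ ((∑ n, C n ^ 2) + r.N + 1) * (2 * S + 1) ^ 6 * irScale S p ^ 2 := by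
          gcongr
          have : 0 ≤ ∑ n, C n ^ 2 := Finset.sum_nonneg fun n _ => sq_nonneg _
          linarith

end Summit.QuantumFields.YangMills.Cruxes.CovarianceBound.SupportWindow

end
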